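import Literature.MathematicalPhysics.QuantumFieldTheory.Balaban1983to89.Node00.OpsYSectEStarRecordP
import Literature.MathematicalPhysics.QuantumFieldTheory.Balaban1983to89.Node00.OpsYRecordV4P
import Literature.MathematicalPhysics.QuantumFieldTheory.Balaban1983to89.B9OpsRTransport
import Literature.MathematicalPhysics.QuantumFieldTheory.Balaban1983to89.B9WalkLettersOps
import Literature.MathematicalPhysics.QuantumFieldTheory.Balaban1983to89.B9Thm39PureGaugeClassAtLettersR
import Literature.MathematicalPhysics.QuantumFieldTheory.Balaban1983to89.B9Thm39OneCubeReadingAtLettersY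
import Literature.MathematicalPhysics.QuantumFieldTheory.Balaban1983to89.B9Thm39WholeBlkViaDatum
import Literature.MathematicalPhysics.QuantumFieldTheory.Balaban1983to89.B9RowSum261DefiniteFaces
import Literature.MathematicalPhysics.QuantumFieldTheory.Balaban1983to89.B9Thm311PosAtRecordV4
import Literature.MathematicalPhysics.QuantumFieldTheory.Balaban1983to89.B9Thm311ReadingAtLetters
import Literature.MathematicalPhysics.QuantumFieldTheory.Balaban1983to89.B9Thm311Whole
import Literature.MathematicalPhysics.QuantumFieldTheory.Balaban1983to89.B9Thm312Whole
import Literature.MathematicalPhysics.QuantumFieldTheory.Balaban1983to89.B9RWSumsDefinitePinsPairMDir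
import Literature.MathematicalPhysics.QuantumFieldTheory.Balaban1983to89.B9CoReadingCoordsTranspose
import Literature.MathematicalPhysics.QuantumFieldTheory.Balaban1983to89.B9CoReadingCoordsH
import Literature.MathematicalPhysics.QuantumFieldTheory.Balaban1983to89.B9GeoNbrCountKLevelV1
import Literature.MathematicalPhysics.QuantumFieldTheory.Balaban1983to89.B6Cover236MultiLevelBlocks

/-!
# `Balaban1983to89.Node00.OpsYExpsOfRecordV2` — T. Bałaban, *Propagators for lattice gauge theories in a background field*, Commun. Math. Phys. **99**
# (1985) 389–434 [Balaban1985BackgroundPropagators], Thms 3.7–3.13 pp. 409–426, regularity classes (3.35)–(3.36) p. 396: THE EXPANSION-LETTER RECORD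
# `𝔈` OF STAGE 3′(Y) IN THE CLASS-PARAMETRIC (`R`-) TYPING OF THE CERTIFICATE OF RECORD — `expsYOfRecordV2`, its seven faces at
# `opsYNuStOfRecordV4PE ∕ opsYStOfRecordV4PE ∕ opsYNuOfRecordV4PE ∕ opsYOfRecordV4PE`, and `pins_of_eq`

statement-level skeleton of published theorems with citation tags; proofs where landed; nothing here is a claim about the Yang–Mills mass gap

THE PRINT.  p. 396: the regularity conditions (3.35)–(3.36) («U restricted to each big cube □̃ … is a small field», «regular») are HYPOTHESES on the
background configuration, i.e. the class of backgrounds is a PARAMETER of every statement of Sect. 3; p. 413 (Theorem 3.9): *«This theorem implies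
Theorem 3.2»*; p. 422: *«Of course Theorem 3.10 holds also because we replace each operator in (3.130) by its random walk expansion»*; p. 423:
*«Replacing the operators in (3.138) by their random walk expansions we get a random walk expansion for G₁»*.  As in `Node00.OpsYExpsOfRecord` (V1),
the expansions of Theorems 3.7 ∕ 3.9 ∕ 3.10, the positivity statements of Theorem 3.11 and the perturbation series of Theorems 3.12 ∕ 3.13 are, in the
N06 certificate, the PREDICATE ∕ EXPANSION LETTERS `E37 ∕ EK39 ∕ E310 ∕ PosDef ∕ HasRWExp ∕ HasRWExpH ∕ PosDefK` of def-Y's `ExpLettersY`, carried by the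
parameter `𝔈 : ExpsY N θ M⋆` of the instances of record.

WHY THIS FILE (pub-ymgap bus 2026-08-29, node00-def-Y g28 INTENT-71; dag-n06-d g17 word «fires on my LANDED line; then `hE37` closes by `rfl` in the
edition after»; director-ym R168 row (2): def-Y owns the `OpsY` instance at the record and its residual operator layer).  Since the class-parametric
(«R») editions, the N06 certificate of record (`Summit.….N06AtOpsYNuOfRecordV6EPairUD`) elaborates against the STAR instance
`opsYNuStOfRecordV4PE N θ M⋆ 𝔯 (sectEStYOfRecordV7 … 𝔢₀) 𝔴 𝔈` with `𝔈` FREE, binds the regularity classes as PARAMETERS `{R₁ R₂ : RegFamY …}`, reads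
every `U`-dependent letter over the class-parametric carrier `bg9YR … R₁ R₂ x` (`B9BackgroundsKLevelV1R`), and DISPLAYS SEVEN PINS tying `𝔈`'s fields —
RE-TYPED by `rwExpansionR ∕ rwKernelExpansionR R₁ R₂` — to the seats' definite readers IN THAT TYPING: `hEK39` (`EK39OfOpsBlkVia` of the one-cube
letters `oneCubeOps39YFR … R₁ R₂ bI x`), `hPD` (`PosDefOfOps (ops311Y …)`), `hE37` (the definite `PairM` E-letter `E37YPairMDir (bg := bg9YR …)` of the
WALK LETTERS OF RECORD `opsWalkY ∕ dirOpsWalkY ∕ dirLettersWalkY ∕ rdWalkY` (`B9WalkLettersOps`) at basis `trBasis N`, transporter `parSymY`), `hE310`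
(`E310YPairM (bg := bg9YR …)` of the bond-sector readers `𝔬A rdA`), `hpinE ∕ hpinH ∕ hpinK` (`…OfOps (ops312RY (𝔬12 x))` of the Sect.-D letters typed
over `bg9YR`).  V1's record `expsYOfRecordV1` is typed over `bg9Y x` with free walk readers `𝔬 𝔡 𝔩 rd` and cannot pin these binders.  This
file defines the record that DOES, so that the edition after may instantiate `𝔈 := expsYOfRecordV2 …` (the seven pins then close by `rfl` — §2) or keep
`𝔈` bound with ONE equation `h𝔈 : 𝔈 = expsYOfRecordV2 …` (§2 `pins_of_eq` recovers the seven named hypotheses in exactly their displayed shapes).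

WHAT THIS FILE DOES (definitions by field copy + `rfl` transport; record-level knit file — it imports the N06 seats' reader modules; nothing in
NODE 00's letter layer imports it; V1 is untouched and not imported):
* §0 ★ the two INVERSE RE-TYPINGS the record needs, `rwExpansionRY ∕ rwKernelExpansionRY` (`bg9YR R₁ R₂ x → bg9Y x`, field copies; the forward
  directions `rwExpansionR ∕ rwKernelExpansionR` are `B9BackgroundsKLevelV1R`'s), their `rfl` round trips and same-term lemmas.
* §1 ★★ `expsYOfRecordV2 N θ M⋆ 𝔯 𝔈₀ R₁ R₂ bI α′ r39 B39 p q p3 q3 pM qM H 𝔬A rdA 𝔬12 : ExpsY N θ M⋆` — the base record `𝔈₀` with the SEVEN pinned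
  fields REPLACED by (the inverse re-typings of) the certificate's right-hand sides VERBATIM; the site ∕ bond kernel families fed to
  `E37YPairMDir ∕ E310YPairM` are `kernelFamilyR R₁ R₂` of the record's own `kernelFamilyS … (𝔏 x).Gp (𝔏 x).parS ∕ kernelFamilyB … (𝔏 x).GA (𝔏 x).parB`,
  `𝔏 := lettersYOfRecordV4P N θ M⋆ 𝔯` — the `rfl`-values of `(opsYNuStOfRecordV4PE …).Gp ∕ .GA`; `IsAnalyticExt`, `GivenBy3185`, `HasRWExpC` are KEPT
  from `𝔈₀`; field lemmas in both typings.
* §2 ★★ the SEVEN FACES at the star instance `opsYNuStOfRecordV4PE N θ M⋆ 𝔯 𝔢 𝔴 (expsYOfRecordV2 …)` for ANY star Sect.-E ∕ walk families `𝔢 𝔴`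
  (so at `sectEStYOfRecordV7 … 𝔢₀` by instantiation), each in EXACTLY the certificate's binder shape (`kernelFamilyR R₁ R₂ (OPS x).Gp ∕ .GA` on the
  right of `hE37 ∕ hE310`), all `rfl`; the conjunction ★★★ `pins_of_eq : 𝔈 = expsYOfRecordV2 … → ⟨hEK39, hPD, hE37, hE310, hpinE, hpinH, hpinK⟩`;
  the same bundles at the plain star instance `opsYStOfRecordV4PE` (`pinsSt_of_eq`) and at the two SOURCE instances `opsYNuOfRecordV4PE ∕
  opsYOfRecordV4PE` (`pinsNu_of_eq ∕ pinsP_of_eq`; any source Sect.-E family `𝔢' : SectEY`).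
NAMES.  §2's face names (`pinEK39 ∕ pinPosDef ∕ pinE37 ∕ pinE310 ∕ pinSectD ∕ isAnalyticExt_eq ∕ pins_of_eq ∕ pinsP_of_eq`) deliberately coincide with
V1's in namespace `…Node00.OpsYExpsOfRecord` (distinct fully-qualified names); a consumer that opens BOTH namespaces must qualify, e.g.
`OpsYExpsOfRecordV2.pins_of_eq h𝔈` (pub-ymgap dag-lead DEDUP WORDS 61).

HONEST SCOPE.  Definitional packaging of def-Y's own residual parameter and `rfl` transport; no inequality, expansion or positivity statement of the
paper is proved or asserted (the fields are PREDICATES whose truth the certificate's rows display as hypotheses); the regularity classes `R₁ R₂`, the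
bond-sector and Sect.-D readers `𝔬A rdA 𝔬12`, the block map `bI`, the local hypothesis `H` and the numerics stay the certificate's binders.  Nothing
landed is modified; N06 is NOT discharged; NOT continuum, NOT OS, NOT the mass gap.  Filed by the pub-ymgap def-Y owner lineage
(`pub-ymgap-node00-def-Y`, gen 28).  Net new unproved facts: 0.
-/

noncomputable section

namespace Literature.MathematicalPhysics.QuantumFieldTheory.Balaban1983to89.Node00.OpsYExpsOfRecordV2

open Node00
open B9PinMembersKLevelV1 (MemberY geo9Y bg9Y)
open B9BackgroundsKLevelV1R (RegFamY bg9YR regY335 regY336 kernelFamilyR rwExpansionR rwKernelExpansionR)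
open B9OpsRTransport (ops312RY)
open B7Prop2SpecialUnitary (specialUnitaryUnits)
open B6Cover236MultiLevelBlocks (cubes)
open B9Thm37Whole (Ops)
open B9Cor38Whole (WalkReading)
open B9Thm310Whole (Ops310 WalkReading310)
open B9Thm311Whole (PosDefOfOps)
open B9Thm311ReadingAtLetters (ops311Y)
open B9Thm311PosAtRecordV4 (proofLettersGA)
open B9Thm39WholeBlkViaDatum (EK39OfOpsBlkVia)
open B9Thm39ReadingFaithful (repSite39F)
open B9Thm39OneCubeReadingAtLettersY (oneCubeReading39)
open B9Thm39PureGaugeClassAtLettersR (oneCubeOps39YFR)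
open B9WalkLettersOps (opsWalkY dirOpsWalkY dirLettersWalkY rdWalkY)
open B9RowSum261DefiniteFaces (rowConst261)
open B9Thm312Whole (HasRWExpOfOps HasRWExpHOfOps PosDefKOfOps)
open B9RWSumsDefinitePins (PinPrims)
open B9RWSumsDefinitePinsPair (PairPrims)
open B9RWSumsDefinitePinsPairM (MixedPrims E310YPairM)
open B9RWSumsDefinitePinsPairMDir (E37YPairMDir)
open B9CoReadingCoordsTranspose (TrIdx trBasis)
open B9CoReadingCoords (XBK)
open B9CoReadingCoordsS (XSK)
open B9CoReadingCoordsH (XHK)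
open B9GeoNbrCountKLevelV1 (nbrCountY)
open scoped Matrix.Norms.L2Operator

/-! ## §0 ★ The inverse re-typings of the two expansion records (`bg9YR R₁ R₂ x → bg9Y x`; field copies) -/

section Retype

variable {d ℓ : ℕ} {hd : 1 ≤ d + 1} {hL : Odd (ℓ + 1) ∧ 1 < ℓ + 1} {b₀ b₁ : ℝ} {Mstar : ℕ}
variable {𝔸 : Type} [NormedRing 𝔸] [NormedAlgebra ℂ 𝔸] [CompleteSpace 𝔸] {G : Subgroup 𝔸ˣ}
variable {R₁ R₂ : RegFamY d ℓ hd hL b₀ b₁ Mstar 𝔸} {x : MemberY d ℓ hd hL b₀ b₁ Mstar}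

/-- a random-walk expansion over `bg9YR R₁ R₂ x` IS one over `bg9Y x` (same configuration type; the eight fields copied) — the inverse of
`B9BackgroundsKLevelV1R.rwExpansionR R₁ R₂`. [cite: Balaban1985BackgroundPropagators, (3.90) p.409 + (3.35)–(3.36) p.396, bookkeeping] -/
def rwExpansionRY (E : B9.RWExpansion (geo9Y x) (bg9YR 𝔸 G R₁ R₂ x)) : B9.RWExpansion (geo9Y x) (bg9Y 𝔸 G x) :=
  ⟨E.Walk, E.wlen, E.first, E.last, E.wdist, E.term, E.LocDep, E.Converges⟩

/-- a random-walk kernel expansion over `bg9YR R₁ R₂ x` IS one over `bg9Y x` — the inverse of `B9BackgroundsKLevelV1R.rwKernelExpansionR R₁ R₂`.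
[cite: Balaban1985BackgroundPropagators, (3.98)–(3.99) pp.412–413 + (3.35)–(3.36) p.396, bookkeeping] -/
def rwKernelExpansionRY (E : B9.RWKernelExpansion (geo9Y x) (bg9YR 𝔸 G R₁ R₂ x)) : B9.RWKernelExpansion (geo9Y x) (bg9Y 𝔸 G x) :=
  ⟨E.Walk, E.wlen, E.wdist, E.kterm, E.LocDep, E.Converges⟩

/-- round trip (structure eta). [cite: Balaban1985BackgroundPropagators, (3.90) p.409, bookkeeping] -/
theorem rwExpansionR_rwExpansionRY (E : B9.RWExpansion (geo9Y x) (bg9YR 𝔸 G R₁ R₂ x)) : rwExpansionR R₁ R₂ (rwExpansionRY E) = E := rfl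
/-- round trip (structure eta). [cite: Balaban1985BackgroundPropagators, (3.90) p.409, bookkeeping] -/
theorem rwExpansionRY_rwExpansionR (E : B9.RWExpansion (geo9Y x) (bg9Y 𝔸 G x)) : rwExpansionRY (rwExpansionR R₁ R₂ E) = E := rfl
/-- same walk terms. [cite: Balaban1985BackgroundPropagators, (3.90) p.409, bookkeeping] -/
theorem rwExpansionRY_term (E : B9.RWExpansion (geo9Y x) (bg9YR 𝔸 G R₁ R₂ x)) : (rwExpansionRY E).term = E.term := rfl
/-- same convergence predicate. [cite: Balaban1985BackgroundPropagators, (3.90) p.409 + Thm 3.2 (3.48) p.398, bookkeeping] -/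
theorem rwExpansionRY_Converges (E : B9.RWExpansion (geo9Y x) (bg9YR 𝔸 G R₁ R₂ x)) : (rwExpansionRY E).Converges = E.Converges := rfl
/-- round trip (structure eta). [cite: Balaban1985BackgroundPropagators, (3.98)–(3.99) pp.412–413, bookkeeping] -/
theorem rwKernelExpansionR_rwKernelExpansionRY (E : B9.RWKernelExpansion (geo9Y x) (bg9YR 𝔸 G R₁ R₂ x)) :
    rwKernelExpansionR R₁ R₂ (rwKernelExpansionRY E) = E := rfl
/-- round trip (structure eta). [cite: Balaban1985BackgroundPropagators, (3.98)–(3.99) pp.412–413, bookkeeping] -/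
theorem rwKernelExpansionRY_rwKernelExpansionR (E : B9.RWKernelExpansion (geo9Y x) (bg9Y 𝔸 G x)) :
    rwKernelExpansionRY (rwKernelExpansionR R₁ R₂ E) = E := rfl
/-- same walk terms. [cite: Balaban1985BackgroundPropagators, (3.98)–(3.99) pp.412–413, bookkeeping] -/
theorem rwKernelExpansionRY_kterm (E : B9.RWKernelExpansion (geo9Y x) (bg9YR 𝔸 G R₁ R₂ x)) : (rwKernelExpansionRY E).kterm = E.kterm := rfl
/-- same convergence predicate. [cite: Balaban1985BackgroundPropagators, (3.98)–(3.99) pp.412–413 + Thm 3.2 (3.48) p.398, bookkeeping] -/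
theorem rwKernelExpansionRY_Converges (E : B9.RWKernelExpansion (geo9Y x) (bg9YR 𝔸 G R₁ R₂ x)) :
    (rwKernelExpansionRY E).Converges = E.Converges := rfl
/-- at MODULE 3's families (`bg9Y x = bg9YR regY335 regY336 x` definitionally) the inverse re-typing is the identity.
[cite: Balaban1985BackgroundPropagators, (3.35)–(3.36) p.396, bookkeeping] -/
theorem rwExpansionRY_regY (E : B9.RWExpansion (geo9Y x) (bg9YR 𝔸 G (regY335 𝔸 G) (regY336 𝔸 G) x)) : rwExpansionRY E = E := rfl
/-- at MODULE 3's families the inverse kernel re-typing is the identity. [cite: Balaban1985BackgroundPropagators, (3.35)–(3.36) p.396, bookkeeping] -/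
theorem rwKernelExpansionRY_regY (E : B9.RWKernelExpansion (geo9Y x) (bg9YR 𝔸 G (regY335 𝔸 G) (regY336 𝔸 G) x)) : rwKernelExpansionRY E = E := rfl

end Retype

/-! ## §1 ★★ The expansion-letter record of record, class-parametric typing -/

section Defn

/-- ★★ **THE EXPANSION LETTERS OF RECORD, `R`-TYPING** `𝔈 := expsYOfRecordV2 N θ M⋆ 𝔯 𝔈₀ R₁ R₂ bI α′ r39 B39 p q p3 q3 pM qM H 𝔬A rdA 𝔬12`: the base
record `𝔈₀` with the seven fields the N06 certificate of record PINS replaced by its right-hand sides, read back to the member carrier `bg9Y x` by the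
inverse re-typings of §0 — Theorem 3.9's kernel expansion of `(Q′G′²Q′*)⁻¹` read blockwise off the one-cube letters over `bg9YR R₁ R₂ x` on the faithful
block map (`EK39`), Theorem 3.11's five positivity statements at the letters (`PosDef`), the definite `PairM` E-letter of Theorems 3.7 ∕ 3.8 over THE WALK
LETTERS OF RECORD `opsWalkY ∕ dirOpsWalkY ∕ dirLettersWalkY ∕ rdWalkY` at basis `trBasis N`, transporter `parSymY`, block map `bI x` (`E37`), the definite
`PairM` E-letter of Theorem 3.10 over the bond-sector readers `𝔬A rdA` (`E310`) — both fed `kernelFamilyR R₁ R₂` of the record's own site ∕ bond kernel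
families — and Theorems 3.12 ∕ 3.13's perturbation series ∕ positivity over the Sect.-D letters `ops312RY (𝔬12 x)` (`HasRWExp ∕ HasRWExpH ∕ PosDefK`);
`IsAnalyticExt ∕ GivenBy3185 ∕ HasRWExpC` are `𝔈₀`'s.
[cite: Balaban1985BackgroundPropagators, Thm 3.7 (3.90) p.409 + Cor. 3.8 (3.93)–(3.94) p.410, Thm 3.9 (3.98)–(3.99) pp.412–413, Thm 3.10 (3.107)–(3.108) pp.415–416,
Thm 3.11 p.416, Thm 3.12 p.423 + (3.130) p.421 + (3.138) p.423, Thm 3.13 p.426 + (3.147)–(3.148) p.425, (3.35)–(3.36) p.396 (the class as a parameter)] -/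
def expsYOfRecordV2 (N : ℕ) (θ : Stage3Params) (Mstar : ℕ) (𝔯 : ResY N θ Mstar) (𝔈₀ : ExpsY N θ Mstar)
    [∀ x : MemberY θ.d₆ θ.ℓ₆ θ.hd' θ.hL' θ.b₀ θ.b₁ Mstar, Fintype (geo9Y x).Site]
    [∀ x : MemberY θ.d₆ θ.ℓ₆ θ.hd' θ.hL' θ.b₀ θ.b₁ Mstar, DecidableEq (geo9Y x).Site]
    (R₁ R₂ : RegFamY θ.d₆ θ.ℓ₆ θ.hd' θ.hL' θ.b₀ θ.b₁ Mstar (Matrix (Fin N) (Fin N) ℂ))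
    (bI : ∀ x : MemberY θ.d₆ θ.ℓ₆ θ.hd' θ.hL' θ.b₀ θ.b₁ Mstar, FBondY x.toKIdx → IBondY x.toKIdx) (α' r39 B39 : ℝ) (p q : PinPrims)
    (p3 q3 : PairPrims) (pM qM : MixedPrims) (H : MemberY θ.d₆ θ.ℓ₆ θ.hd' θ.hL' θ.b₀ θ.b₁ Mstar → Prop)
    {ιA AA : MemberY θ.d₆ θ.ℓ₆ θ.hd' θ.hL' θ.b₀ θ.b₁ Mstar → Type} [∀ x, Fintype (ιA x)] [∀ x, Fintype (AA x)]
    (𝔬A : ∀ x : MemberY θ.d₆ θ.ℓ₆ θ.hd' θ.hL' θ.b₀ θ.b₁ Mstar, Ops310 (geo9Y x)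
      (bg9YR (Matrix (Fin N) (Fin N) ℂ) (specialUnitaryUnits (Fin N)) R₁ R₂ x) (XBK (TrIdx N) x.toKIdx) (XBK (TrIdx N) x.toKIdx) (ιA x) (AA x))
    (rdA : ∀ x : MemberY θ.d₆ θ.ℓ₆ θ.hd' θ.hL' θ.b₀ θ.b₁ Mstar, WalkReading310 (geo9Y x)
      (bg9YR (Matrix (Fin N) (Fin N) ℂ) (specialUnitaryUnits (Fin N)) R₁ R₂ x) (XBK (TrIdx N) x.toKIdx) (ιA x) (AA x))
    (𝔬12 : ∀ x : MemberY θ.d₆ θ.ℓ₆ θ.hd' θ.hL' θ.b₀ θ.b₁ Mstar, B9Thm312Whole.Ops (geo9Y x)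
      (bg9YR (Matrix (Fin N) (Fin N) ℂ) (specialUnitaryUnits (Fin N)) R₁ R₂ x) (XBK (TrIdx N) x.toKIdx) (XBK (TrIdx N) x.toKIdx) (XHK (TrIdx N) x.toKIdx)
      (XSK (TrIdx N) x.toKIdx)) :
    ExpsY N θ Mstar := fun x =>
  { 𝔈₀ x with
    EK39 := rwKernelExpansionRY
      (EK39OfOpsBlkVia (oneCubeOps39YFR θ Mstar (lettersYOfRecordV4P N θ Mstar 𝔯) R₁ R₂ bI x) (oneCubeReading39 _) (θ.d₆ + 1)
        (2 * (1 * B39) * rowConst261 (geo9Y (d := θ.d₆) (ℓ := θ.ℓ₆) (hd := θ.hd') (hL := θ.hL') (b₀ := θ.b₀) (b₁ := θ.b₁) (Mstar := Mstar)) (α' * r39))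
        ((1 - α') * r39) (repSite39F x.toKIdx (bI x)))
    PosDef := PosDefOfOps (ops311Y x (lettersYOfRecordV4P N θ Mstar 𝔯 x) (proofLettersGA (lettersYOfRecordV4P N θ Mstar 𝔯 x)))
    E37 := rwExpansionRY
      (E37YPairMDir (bg := (bg9YR (Matrix (Fin N) (Fin N) ℂ) (specialUnitaryUnits (Fin N)) R₁ R₂)) (2 * (θ.d₆ + 1))
        (nbrCountY θ.d₆ θ.ℓ₆ θ.hd' θ.hL' θ.b₀ θ.b₁ 2) (Real.sqrt ((θ.d₆ + 1) * Fintype.card (TrIdx N))) ((θ.d₆ + 1 : ℕ) : ℝ) p q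
        (⟨p3.N3, 2 * p3.B3, 0⟩ : PairPrims) (⟨q3.N3, 2 * q3.B3, 0⟩ : PairPrims) pM qM
        (opsWalkY x (trBasis N) (bg9YR (Matrix (Fin N) (Fin N) ℂ) (specialUnitaryUnits (Fin N)) R₁ R₂ x) (fun U => U) (parSymY x.toKIdx) (bI x))
        (dirOpsWalkY x (trBasis N) (bg9YR (Matrix (Fin N) (Fin N) ℂ) (specialUnitaryUnits (Fin N)) R₁ R₂ x) (fun U => U) (parSymY x.toKIdx) (bI x))
        (dirLettersWalkY x (trBasis N) (bg9YR (Matrix (Fin N) (Fin N) ℂ) (specialUnitaryUnits (Fin N)) R₁ R₂ x) (fun U => U) (parSymY x.toKIdx) (bI x))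
        (rdWalkY x (bg9YR (Matrix (Fin N) (Fin N) ℂ) (specialUnitaryUnits (Fin N)) R₁ R₂ x) (fun U => U) (parSymY x.toKIdx)) (H x)
        (kernelFamilyR R₁ R₂
          (kernelFamilyS x.toKIdx (bg9Y (Matrix (Fin N) (Fin N) ℂ) (specialUnitaryUnits (Fin N)) x) (fun U => U) (lettersYOfRecordV4P N θ Mstar 𝔯 x).Gp
            (lettersYOfRecordV4P N θ Mstar 𝔯 x).parS)))
    E310 := rwExpansionRY
      (E310YPairM (bg := (bg9YR (Matrix (Fin N) (Fin N) ℂ) (specialUnitaryUnits (Fin N)) R₁ R₂)) (2 * (θ.d₆ + 1))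
        (nbrCountY θ.d₆ θ.ℓ₆ θ.hd' θ.hL' θ.b₀ θ.b₁ 2) (Real.sqrt ((θ.d₆ + 1) * Fintype.card (TrIdx N))) ((θ.d₆ + 1 : ℕ) : ℝ) p q
        (⟨p3.N3, 2 * p3.B3, 0⟩ : PairPrims) (⟨q3.N3, 2 * q3.B3, 0⟩ : PairPrims) pM qM (𝔬A x) (rdA x) (H x)
        (kernelFamilyR R₁ R₂
          (kernelFamilyB x.toKIdx (bg9Y (Matrix (Fin N) (Fin N) ℂ) (specialUnitaryUnits (Fin N)) x) (fun U => U) (lettersYOfRecordV4P N θ Mstar 𝔯 x).GA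
            (lettersYOfRecordV4P N θ Mstar 𝔯 x).parB)))
    HasRWExp := HasRWExpOfOps (ops312RY (𝔬12 x))
    HasRWExpH := HasRWExpHOfOps (ops312RY (𝔬12 x))
    PosDefK := PosDefKOfOps (ops312RY (𝔬12 x)) }

end Defn

section Faces

variable (N : ℕ) (θ : Stage3Params) (Mstar : ℕ) (𝔯 : ResY N θ Mstar) (𝔈₀ : ExpsY N θ Mstar)
  [∀ x : MemberY θ.d₆ θ.ℓ₆ θ.hd' θ.hL' θ.b₀ θ.b₁ Mstar, Fintype (geo9Y x).Site]
  [∀ x : MemberY θ.d₆ θ.ℓ₆ θ.hd' θ.hL' θ.b₀ θ.b₁ Mstar, DecidableEq (geo9Y x).Site]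
  (R₁ R₂ : RegFamY θ.d₆ θ.ℓ₆ θ.hd' θ.hL' θ.b₀ θ.b₁ Mstar (Matrix (Fin N) (Fin N) ℂ))
  (bI : ∀ x : MemberY θ.d₆ θ.ℓ₆ θ.hd' θ.hL' θ.b₀ θ.b₁ Mstar, FBondY x.toKIdx → IBondY x.toKIdx) (α' r39 B39 : ℝ) (p q : PinPrims)
  (p3 q3 : PairPrims) (pM qM : MixedPrims) (H : MemberY θ.d₆ θ.ℓ₆ θ.hd' θ.hL' θ.b₀ θ.b₁ Mstar → Prop)
  {ιA AA : MemberY θ.d₆ θ.ℓ₆ θ.hd' θ.hL' θ.b₀ θ.b₁ Mstar → Type} [∀ x, Fintype (ιA x)] [∀ x, Fintype (AA x)]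
  (𝔬A : ∀ x : MemberY θ.d₆ θ.ℓ₆ θ.hd' θ.hL' θ.b₀ θ.b₁ Mstar, Ops310 (geo9Y x)
    (bg9YR (Matrix (Fin N) (Fin N) ℂ) (specialUnitaryUnits (Fin N)) R₁ R₂ x) (XBK (TrIdx N) x.toKIdx) (XBK (TrIdx N) x.toKIdx) (ιA x) (AA x))
  (rdA : ∀ x : MemberY θ.d₆ θ.ℓ₆ θ.hd' θ.hL' θ.b₀ θ.b₁ Mstar, WalkReading310 (geo9Y x)
    (bg9YR (Matrix (Fin N) (Fin N) ℂ) (specialUnitaryUnits (Fin N)) R₁ R₂ x) (XBK (TrIdx N) x.toKIdx) (ιA x) (AA x))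
  (𝔬12 : ∀ x : MemberY θ.d₆ θ.ℓ₆ θ.hd' θ.hL' θ.b₀ θ.b₁ Mstar, B9Thm312Whole.Ops (geo9Y x)
    (bg9YR (Matrix (Fin N) (Fin N) ℂ) (specialUnitaryUnits (Fin N)) R₁ R₂ x) (XBK (TrIdx N) x.toKIdx) (XBK (TrIdx N) x.toKIdx) (XHK (TrIdx N) x.toKIdx)
    (XSK (TrIdx N) x.toKIdx))

/-! ### §1 continued: field lemmas -/

/-- the three fields KEPT from the base record: the analyticity predicate (row 13's fourth slot; Sect.-B content) and the two Sect.-E predicates.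
[cite: Balaban1985BackgroundPropagators, (3.69)–(3.70) p.404, Thm 3.15 (3.185)–(3.187) p.432, bookkeeping] -/
theorem expsYOfRecordV2_kept (x : MemberY θ.d₆ θ.ℓ₆ θ.hd' θ.hL' θ.b₀ θ.b₁ Mstar) :
    (expsYOfRecordV2 N θ Mstar 𝔯 𝔈₀ R₁ R₂ bI α' r39 B39 p q p3 q3 pM qM H 𝔬A rdA 𝔬12 x).IsAnalyticExt = (𝔈₀ x).IsAnalyticExt ∧
      (expsYOfRecordV2 N θ Mstar 𝔯 𝔈₀ R₁ R₂ bI α' r39 B39 p q p3 q3 pM qM H 𝔬A rdA 𝔬12 x).GivenBy3185 = (𝔈₀ x).GivenBy3185 ∧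
      (expsYOfRecordV2 N θ Mstar 𝔯 𝔈₀ R₁ R₂ bI α' r39 B39 p q p3 q3 pM qM H 𝔬A rdA 𝔬12 x).HasRWExpC = (𝔈₀ x).HasRWExpC := ⟨rfl, rfl, rfl⟩

/-- the record at a base that already IS a record of record is itself (the seven replaced fields do not read `𝔈₀`). [cite: Balaban1985BackgroundPropagators, Thms 3.7–3.13 pp.409–426, bookkeeping] -/
theorem expsYOfRecordV2_idem :
    expsYOfRecordV2 N θ Mstar 𝔯 (expsYOfRecordV2 N θ Mstar 𝔯 𝔈₀ R₁ R₂ bI α' r39 B39 p q p3 q3 pM qM H 𝔬A rdA 𝔬12) R₁ R₂ bI α' r39 B39 p q p3 q3 pM qM H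
        𝔬A rdA 𝔬12 =
      expsYOfRecordV2 N θ Mstar 𝔯 𝔈₀ R₁ R₂ bI α' r39 B39 p q p3 q3 pM qM H 𝔬A rdA 𝔬12 := rfl

/-- the three Theorem-3.12∕3.13 fields ARE the `…OfOps` predicates of the Sect.-D letters read back to `bg9Y x`. [cite: Balaban1985BackgroundPropagators, Thm 3.12 p.423, Thm 3.13 p.426, bookkeeping] -/
theorem expsYOfRecordV2_sectD (x : MemberY θ.d₆ θ.ℓ₆ θ.hd' θ.hL' θ.b₀ θ.b₁ Mstar) :
    (expsYOfRecordV2 N θ Mstar 𝔯 𝔈₀ R₁ R₂ bI α' r39 B39 p q p3 q3 pM qM H 𝔬A rdA 𝔬12 x).HasRWExp = HasRWExpOfOps (ops312RY (𝔬12 x)) ∧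
      (expsYOfRecordV2 N θ Mstar 𝔯 𝔈₀ R₁ R₂ bI α' r39 B39 p q p3 q3 pM qM H 𝔬A rdA 𝔬12 x).HasRWExpH = HasRWExpHOfOps (ops312RY (𝔬12 x)) ∧
      (expsYOfRecordV2 N θ Mstar 𝔯 𝔈₀ R₁ R₂ bI α' r39 B39 p q p3 q3 pM qM H 𝔬A rdA 𝔬12 x).PosDefK = PosDefKOfOps (ops312RY (𝔬12 x)) := ⟨rfl, rfl, rfl⟩

/-- the Theorem-3.11 field IS `PosDefOfOps` at the letters of record with the trivial parametrix proof letters. [cite: Balaban1985BackgroundPropagators, Thm 3.11 p.416, bookkeeping] -/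
theorem expsYOfRecordV2_posDef (x : MemberY θ.d₆ θ.ℓ₆ θ.hd' θ.hL' θ.b₀ θ.b₁ Mstar) :
    (expsYOfRecordV2 N θ Mstar 𝔯 𝔈₀ R₁ R₂ bI α' r39 B39 p q p3 q3 pM qM H 𝔬A rdA 𝔬12 x).PosDef =
      PosDefOfOps (ops311Y x (lettersYOfRecordV4P N θ Mstar 𝔯 x) (proofLettersGA (lettersYOfRecordV4P N θ Mstar 𝔯 x))) := rfl

/-- the Theorem-3.9 field, RE-TYPED over `bg9YR R₁ R₂ x`, IS `EK39OfOpsBlkVia` of the one-cube letters on the faithful block map.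
[cite: Balaban1985BackgroundPropagators, Thm 3.9 (3.98)–(3.99) pp.412–413 + Thm 3.2 (3.48) p.398, bookkeeping] -/
theorem expsYOfRecordV2_EK39 (x : MemberY θ.d₆ θ.ℓ₆ θ.hd' θ.hL' θ.b₀ θ.b₁ Mstar) :
    rwKernelExpansionR R₁ R₂ (expsYOfRecordV2 N θ Mstar 𝔯 𝔈₀ R₁ R₂ bI α' r39 B39 p q p3 q3 pM qM H 𝔬A rdA 𝔬12 x).EK39 =
      EK39OfOpsBlkVia (oneCubeOps39YFR θ Mstar (lettersYOfRecordV4P N θ Mstar 𝔯) R₁ R₂ bI x) (oneCubeReading39 _) (θ.d₆ + 1)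
        (2 * (1 * B39) * rowConst261 (geo9Y (d := θ.d₆) (ℓ := θ.ℓ₆) (hd := θ.hd') (hL := θ.hL') (b₀ := θ.b₀) (b₁ := θ.b₁) (Mstar := Mstar)) (α' * r39))
        ((1 - α') * r39) (repSite39F x.toKIdx (bI x)) := rfl

/-- the Theorem-3.7∕3.8 field, RE-TYPED over `bg9YR R₁ R₂ x`, IS the definite `PairM` E-letter of the walk letters of record fed `kernelFamilyR R₁ R₂` of the
record's own site kernel family. [cite: Balaban1985BackgroundPropagators, Thm 3.7 (3.90) p.409 + Cor. 3.8 (3.93)–(3.94) p.410, bookkeeping] -/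
theorem expsYOfRecordV2_E37 (x : MemberY θ.d₆ θ.ℓ₆ θ.hd' θ.hL' θ.b₀ θ.b₁ Mstar) :
    rwExpansionR R₁ R₂ (expsYOfRecordV2 N θ Mstar 𝔯 𝔈₀ R₁ R₂ bI α' r39 B39 p q p3 q3 pM qM H 𝔬A rdA 𝔬12 x).E37 =
      E37YPairMDir (bg := (bg9YR (Matrix (Fin N) (Fin N) ℂ) (specialUnitaryUnits (Fin N)) R₁ R₂)) (2 * (θ.d₆ + 1))
        (nbrCountY θ.d₆ θ.ℓ₆ θ.hd' θ.hL' θ.b₀ θ.b₁ 2) (Real.sqrt ((θ.d₆ + 1) * Fintype.card (TrIdx N))) ((θ.d₆ + 1 : ℕ) : ℝ) p q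
        (⟨p3.N3, 2 * p3.B3, 0⟩ : PairPrims) (⟨q3.N3, 2 * q3.B3, 0⟩ : PairPrims) pM qM
        (opsWalkY x (trBasis N) (bg9YR (Matrix (Fin N) (Fin N) ℂ) (specialUnitaryUnits (Fin N)) R₁ R₂ x) (fun U => U) (parSymY x.toKIdx) (bI x))
        (dirOpsWalkY x (trBasis N) (bg9YR (Matrix (Fin N) (Fin N) ℂ) (specialUnitaryUnits (Fin N)) R₁ R₂ x) (fun U => U) (parSymY x.toKIdx) (bI x))
        (dirLettersWalkY x (trBasis N) (bg9YR (Matrix (Fin N) (Fin N) ℂ) (specialUnitaryUnits (Fin N)) R₁ R₂ x) (fun U => U) (parSymY x.toKIdx) (bI x))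
        (rdWalkY x (bg9YR (Matrix (Fin N) (Fin N) ℂ) (specialUnitaryUnits (Fin N)) R₁ R₂ x) (fun U => U) (parSymY x.toKIdx)) (H x)
        (kernelFamilyR R₁ R₂
          (kernelFamilyS x.toKIdx (bg9Y (Matrix (Fin N) (Fin N) ℂ) (specialUnitaryUnits (Fin N)) x) (fun U => U) (lettersYOfRecordV4P N θ Mstar 𝔯 x).Gp
            (lettersYOfRecordV4P N θ Mstar 𝔯 x).parS)) := rfl

/-- the Theorem-3.10 field, RE-TYPED over `bg9YR R₁ R₂ x`, IS the definite `PairM` E-letter of the bond-sector readers fed `kernelFamilyR R₁ R₂` of the record's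
own bond kernel family. [cite: Balaban1985BackgroundPropagators, Thm 3.10 (3.107)–(3.108) pp.415–416, bookkeeping] -/
theorem expsYOfRecordV2_E310 (x : MemberY θ.d₆ θ.ℓ₆ θ.hd' θ.hL' θ.b₀ θ.b₁ Mstar) :
    rwExpansionR R₁ R₂ (expsYOfRecordV2 N θ Mstar 𝔯 𝔈₀ R₁ R₂ bI α' r39 B39 p q p3 q3 pM qM H 𝔬A rdA 𝔬12 x).E310 =
      E310YPairM (bg := (bg9YR (Matrix (Fin N) (Fin N) ℂ) (specialUnitaryUnits (Fin N)) R₁ R₂)) (2 * (θ.d₆ + 1))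
        (nbrCountY θ.d₆ θ.ℓ₆ θ.hd' θ.hL' θ.b₀ θ.b₁ 2) (Real.sqrt ((θ.d₆ + 1) * Fintype.card (TrIdx N))) ((θ.d₆ + 1 : ℕ) : ℝ) p q
        (⟨p3.N3, 2 * p3.B3, 0⟩ : PairPrims) (⟨q3.N3, 2 * q3.B3, 0⟩ : PairPrims) pM qM (𝔬A x) (rdA x) (H x)
        (kernelFamilyR R₁ R₂
          (kernelFamilyB x.toKIdx (bg9Y (Matrix (Fin N) (Fin N) ℂ) (specialUnitaryUnits (Fin N)) x) (fun U => U) (lettersYOfRecordV4P N θ Mstar 𝔯 x).GA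
            (lettersYOfRecordV4P N θ Mstar 𝔯 x).parB)) := rfl

/-! ## §2 ★★ The seven faces at the instances of record, in the certificate's binder shapes -/

variable (𝔢 : SectEStY N θ Mstar) (𝔴 : RWEY N θ Mstar)

/-- ★ `hEK39` at the `ν`-read STAR instance of record fed `expsYOfRecordV2`. [cite: Balaban1985BackgroundPropagators, Thm 3.9 (3.98)–(3.99) pp.412–413 + Thm 3.2 (3.48) p.398, bookkeeping] -/
theorem pinEK39 (x : MemberY θ.d₆ θ.ℓ₆ θ.hd' θ.hL' θ.b₀ θ.b₁ Mstar) :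
    rwKernelExpansionR R₁ R₂
        ((opsYNuStOfRecordV4PE N θ Mstar 𝔯 𝔢 𝔴 (expsYOfRecordV2 N θ Mstar 𝔯 𝔈₀ R₁ R₂ bI α' r39 B39 p q p3 q3 pM qM H 𝔬A rdA 𝔬12)) x).EK39 =
      EK39OfOpsBlkVia (oneCubeOps39YFR θ Mstar (lettersYOfRecordV4P N θ Mstar 𝔯) R₁ R₂ bI x) (oneCubeReading39 _) (θ.d₆ + 1)
        (2 * (1 * B39) * rowConst261 (geo9Y (d := θ.d₆) (ℓ := θ.ℓ₆) (hd := θ.hd') (hL := θ.hL') (b₀ := θ.b₀) (b₁ := θ.b₁) (Mstar := Mstar)) (α' * r39))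
        ((1 - α') * r39) (repSite39F x.toKIdx (bI x)) := rfl

/-- ★ `hPD` at the `ν`-read star instance of record fed `expsYOfRecordV2`. [cite: Balaban1985BackgroundPropagators, Thm 3.11 p.416, bookkeeping] -/
theorem pinPosDef (x : MemberY θ.d₆ θ.ℓ₆ θ.hd' θ.hL' θ.b₀ θ.b₁ Mstar) :
    ((opsYNuStOfRecordV4PE N θ Mstar 𝔯 𝔢 𝔴 (expsYOfRecordV2 N θ Mstar 𝔯 𝔈₀ R₁ R₂ bI α' r39 B39 p q p3 q3 pM qM H 𝔬A rdA 𝔬12)) x).PosDef =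
      PosDefOfOps (ops311Y x (lettersYOfRecordV4P N θ Mstar 𝔯 x) (proofLettersGA (lettersYOfRecordV4P N θ Mstar 𝔯 x))) := rfl

/-- ★ `hE37` at the `ν`-read star instance of record fed `expsYOfRecordV2` — the site kernel family on the right is `kernelFamilyR R₁ R₂` of the instance's
OWN `.Gp`, verbatim as displayed. [cite: Balaban1985BackgroundPropagators, Thm 3.7 (3.90) p.409 + Cor. 3.8 (3.93)–(3.94) p.410, bookkeeping] -/
theorem pinE37 (x : MemberY θ.d₆ θ.ℓ₆ θ.hd' θ.hL' θ.b₀ θ.b₁ Mstar) :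
    rwExpansionR R₁ R₂
        ((opsYNuStOfRecordV4PE N θ Mstar 𝔯 𝔢 𝔴 (expsYOfRecordV2 N θ Mstar 𝔯 𝔈₀ R₁ R₂ bI α' r39 B39 p q p3 q3 pM qM H 𝔬A rdA 𝔬12)) x).E37 =
      E37YPairMDir (bg := (bg9YR (Matrix (Fin N) (Fin N) ℂ) (specialUnitaryUnits (Fin N)) R₁ R₂)) (2 * (θ.d₆ + 1))
        (nbrCountY θ.d₆ θ.ℓ₆ θ.hd' θ.hL' θ.b₀ θ.b₁ 2) (Real.sqrt ((θ.d₆ + 1) * Fintype.card (TrIdx N))) ((θ.d₆ + 1 : ℕ) : ℝ) p q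
        (⟨p3.N3, 2 * p3.B3, 0⟩ : PairPrims) (⟨q3.N3, 2 * q3.B3, 0⟩ : PairPrims) pM qM
        (opsWalkY x (trBasis N) (bg9YR (Matrix (Fin N) (Fin N) ℂ) (specialUnitaryUnits (Fin N)) R₁ R₂ x) (fun U => U) (parSymY x.toKIdx) (bI x))
        (dirOpsWalkY x (trBasis N) (bg9YR (Matrix (Fin N) (Fin N) ℂ) (specialUnitaryUnits (Fin N)) R₁ R₂ x) (fun U => U) (parSymY x.toKIdx) (bI x))
        (dirLettersWalkY x (trBasis N) (bg9YR (Matrix (Fin N) (Fin N) ℂ) (specialUnitaryUnits (Fin N)) R₁ R₂ x) (fun U => U) (parSymY x.toKIdx) (bI x))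
        (rdWalkY x (bg9YR (Matrix (Fin N) (Fin N) ℂ) (specialUnitaryUnits (Fin N)) R₁ R₂ x) (fun U => U) (parSymY x.toKIdx)) (H x)
        (kernelFamilyR R₁ R₂
          ((opsYNuStOfRecordV4PE N θ Mstar 𝔯 𝔢 𝔴 (expsYOfRecordV2 N θ Mstar 𝔯 𝔈₀ R₁ R₂ bI α' r39 B39 p q p3 q3 pM qM H 𝔬A rdA 𝔬12)) x).Gp) := rfl

/-- ★ `hE310` at the `ν`-read star instance of record fed `expsYOfRecordV2` — the bond kernel family on the right is `kernelFamilyR R₁ R₂` of the instance's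
OWN `.GA`, verbatim as displayed. [cite: Balaban1985BackgroundPropagators, Thm 3.10 (3.107)–(3.108) pp.415–416, bookkeeping] -/
theorem pinE310 (x : MemberY θ.d₆ θ.ℓ₆ θ.hd' θ.hL' θ.b₀ θ.b₁ Mstar) :
    rwExpansionR R₁ R₂
        ((opsYNuStOfRecordV4PE N θ Mstar 𝔯 𝔢 𝔴 (expsYOfRecordV2 N θ Mstar 𝔯 𝔈₀ R₁ R₂ bI α' r39 B39 p q p3 q3 pM qM H 𝔬A rdA 𝔬12)) x).E310 =
      E310YPairM (bg := (bg9YR (Matrix (Fin N) (Fin N) ℂ) (specialUnitaryUnits (Fin N)) R₁ R₂)) (2 * (θ.d₆ + 1))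
        (nbrCountY θ.d₆ θ.ℓ₆ θ.hd' θ.hL' θ.b₀ θ.b₁ 2) (Real.sqrt ((θ.d₆ + 1) * Fintype.card (TrIdx N))) ((θ.d₆ + 1 : ℕ) : ℝ) p q
        (⟨p3.N3, 2 * p3.B3, 0⟩ : PairPrims) (⟨q3.N3, 2 * q3.B3, 0⟩ : PairPrims) pM qM (𝔬A x) (rdA x) (H x)
        (kernelFamilyR R₁ R₂
          ((opsYNuStOfRecordV4PE N θ Mstar 𝔯 𝔢 𝔴 (expsYOfRecordV2 N θ Mstar 𝔯 𝔈₀ R₁ R₂ bI α' r39 B39 p q p3 q3 pM qM H 𝔬A rdA 𝔬12)) x).GA) := rfl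

/-- ★ `hpinE ∕ hpinH ∕ hpinK` at the `ν`-read star instance of record fed `expsYOfRecordV2`. [cite: Balaban1985BackgroundPropagators, Thm 3.12 p.423, Thm 3.13 p.426, bookkeeping] -/
theorem pinSectD (x : MemberY θ.d₆ θ.ℓ₆ θ.hd' θ.hL' θ.b₀ θ.b₁ Mstar) :
    ((opsYNuStOfRecordV4PE N θ Mstar 𝔯 𝔢 𝔴 (expsYOfRecordV2 N θ Mstar 𝔯 𝔈₀ R₁ R₂ bI α' r39 B39 p q p3 q3 pM qM H 𝔬A rdA 𝔬12)) x).HasRWExp =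
        HasRWExpOfOps (ops312RY (𝔬12 x)) ∧
      ((opsYNuStOfRecordV4PE N θ Mstar 𝔯 𝔢 𝔴 (expsYOfRecordV2 N θ Mstar 𝔯 𝔈₀ R₁ R₂ bI α' r39 B39 p q p3 q3 pM qM H 𝔬A rdA 𝔬12)) x).HasRWExpH =
        HasRWExpHOfOps (ops312RY (𝔬12 x)) ∧
      ((opsYNuStOfRecordV4PE N θ Mstar 𝔯 𝔢 𝔴 (expsYOfRecordV2 N θ Mstar 𝔯 𝔈₀ R₁ R₂ bI α' r39 B39 p q p3 q3 pM qM H 𝔬A rdA 𝔬12)) x).PosDefK =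
        PosDefKOfOps (ops312RY (𝔬12 x)) := ⟨rfl, rfl, rfl⟩

/-- the analyticity predicate of the `ν`-read star instance of record fed `expsYOfRecordV2` is STILL the base record's (free). [cite: Balaban1985BackgroundPropagators, (3.69)–(3.70) p.404, bookkeeping] -/
theorem isAnalyticExt_eq (x : MemberY θ.d₆ θ.ℓ₆ θ.hd' θ.hL' θ.b₀ θ.b₁ Mstar) :
    ((opsYNuStOfRecordV4PE N θ Mstar 𝔯 𝔢 𝔴 (expsYOfRecordV2 N θ Mstar 𝔯 𝔈₀ R₁ R₂ bI α' r39 B39 p q p3 q3 pM qM H 𝔬A rdA 𝔬12)) x).IsAnalyticExt =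
      (𝔈₀ x).IsAnalyticExt := rfl

variable {N θ Mstar 𝔯 𝔈₀ R₁ R₂ bI α' r39 B39 p q p3 q3 pM qM H 𝔬A rdA 𝔬12 𝔢 𝔴}

/-- ★★★ **THE SEVEN PINS FROM ONE EQUATION** at the `ν`-read STAR instance of record (the certificate of record's `OPS`): if the certificate's `𝔈` IS
`expsYOfRecordV2 …`, the displayed binders `hEK39 ∕ hPD ∕ hE37 ∕ hE310 ∕ hpinE ∕ hpinH ∕ hpinK` hold, in exactly their shapes (obtain them with one
`obtain ⟨hEK39, hPD, hE37, hE310, hpinE, hpinH, hpinK⟩ := pins_of_eq h𝔈`).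
[cite: Balaban1985BackgroundPropagators, Thm 3.7 (3.90) p.409, Thm 3.9 (3.98)–(3.99) pp.412–413, Thm 3.10 (3.107)–(3.108) pp.415–416, Thm 3.11 p.416, Thm 3.12 p.423,
Thm 3.13 p.426, (3.35)–(3.36) p.396, bookkeeping] -/
theorem pins_of_eq {𝔈 : ExpsY N θ Mstar}
    (h𝔈 : 𝔈 = expsYOfRecordV2 N θ Mstar 𝔯 𝔈₀ R₁ R₂ bI α' r39 B39 p q p3 q3 pM qM H 𝔬A rdA 𝔬12) :
    (∀ x : MemberY θ.d₆ θ.ℓ₆ θ.hd' θ.hL' θ.b₀ θ.b₁ Mstar, rwKernelExpansionR R₁ R₂ ((opsYNuStOfRecordV4PE N θ Mstar 𝔯 𝔢 𝔴 𝔈) x).EK39 =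
        EK39OfOpsBlkVia (oneCubeOps39YFR θ Mstar (lettersYOfRecordV4P N θ Mstar 𝔯) R₁ R₂ bI x) (oneCubeReading39 _) (θ.d₆ + 1)
          (2 * (1 * B39) * rowConst261 (geo9Y (d := θ.d₆) (ℓ := θ.ℓ₆) (hd := θ.hd') (hL := θ.hL') (b₀ := θ.b₀) (b₁ := θ.b₁) (Mstar := Mstar)) (α' * r39))
          ((1 - α') * r39) (repSite39F x.toKIdx (bI x))) ∧
      (∀ x : MemberY θ.d₆ θ.ℓ₆ θ.hd' θ.hL' θ.b₀ θ.b₁ Mstar, ((opsYNuStOfRecordV4PE N θ Mstar 𝔯 𝔢 𝔴 𝔈) x).PosDef =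
        PosDefOfOps (ops311Y x (lettersYOfRecordV4P N θ Mstar 𝔯 x) (proofLettersGA (lettersYOfRecordV4P N θ Mstar 𝔯 x)))) ∧
      (∀ x : MemberY θ.d₆ θ.ℓ₆ θ.hd' θ.hL' θ.b₀ θ.b₁ Mstar, rwExpansionR R₁ R₂ ((opsYNuStOfRecordV4PE N θ Mstar 𝔯 𝔢 𝔴 𝔈) x).E37 =
        E37YPairMDir (bg := (bg9YR (Matrix (Fin N) (Fin N) ℂ) (specialUnitaryUnits (Fin N)) R₁ R₂)) (2 * (θ.d₆ + 1))
          (nbrCountY θ.d₆ θ.ℓ₆ θ.hd' θ.hL' θ.b₀ θ.b₁ 2) (Real.sqrt ((θ.d₆ + 1) * Fintype.card (TrIdx N))) ((θ.d₆ + 1 : ℕ) : ℝ) p q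
          (⟨p3.N3, 2 * p3.B3, 0⟩ : PairPrims) (⟨q3.N3, 2 * q3.B3, 0⟩ : PairPrims) pM qM
          (opsWalkY x (trBasis N) (bg9YR (Matrix (Fin N) (Fin N) ℂ) (specialUnitaryUnits (Fin N)) R₁ R₂ x) (fun U => U) (parSymY x.toKIdx) (bI x))
          (dirOpsWalkY x (trBasis N) (bg9YR (Matrix (Fin N) (Fin N) ℂ) (specialUnitaryUnits (Fin N)) R₁ R₂ x) (fun U => U) (parSymY x.toKIdx) (bI x))
          (dirLettersWalkY x (trBasis N) (bg9YR (Matrix (Fin N) (Fin N) ℂ) (specialUnitaryUnits (Fin N)) R₁ R₂ x) (fun U => U) (parSymY x.toKIdx) (bI x))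
          (rdWalkY x (bg9YR (Matrix (Fin N) (Fin N) ℂ) (specialUnitaryUnits (Fin N)) R₁ R₂ x) (fun U => U) (parSymY x.toKIdx)) (H x)
          (kernelFamilyR R₁ R₂ ((opsYNuStOfRecordV4PE N θ Mstar 𝔯 𝔢 𝔴 𝔈) x).Gp)) ∧
      (∀ x : MemberY θ.d₆ θ.ℓ₆ θ.hd' θ.hL' θ.b₀ θ.b₁ Mstar, rwExpansionR R₁ R₂ ((opsYNuStOfRecordV4PE N θ Mstar 𝔯 𝔢 𝔴 𝔈) x).E310 =
        E310YPairM (bg := (bg9YR (Matrix (Fin N) (Fin N) ℂ) (specialUnitaryUnits (Fin N)) R₁ R₂)) (2 * (θ.d₆ + 1))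
          (nbrCountY θ.d₆ θ.ℓ₆ θ.hd' θ.hL' θ.b₀ θ.b₁ 2) (Real.sqrt ((θ.d₆ + 1) * Fintype.card (TrIdx N))) ((θ.d₆ + 1 : ℕ) : ℝ) p q
          (⟨p3.N3, 2 * p3.B3, 0⟩ : PairPrims) (⟨q3.N3, 2 * q3.B3, 0⟩ : PairPrims) pM qM (𝔬A x) (rdA x) (H x)
          (kernelFamilyR R₁ R₂ ((opsYNuStOfRecordV4PE N θ Mstar 𝔯 𝔢 𝔴 𝔈) x).GA)) ∧
      (∀ x : MemberY θ.d₆ θ.ℓ₆ θ.hd' θ.hL' θ.b₀ θ.b₁ Mstar, ((opsYNuStOfRecordV4PE N θ Mstar 𝔯 𝔢 𝔴 𝔈) x).HasRWExp = HasRWExpOfOps (ops312RY (𝔬12 x))) ∧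
      (∀ x : MemberY θ.d₆ θ.ℓ₆ θ.hd' θ.hL' θ.b₀ θ.b₁ Mstar, ((opsYNuStOfRecordV4PE N θ Mstar 𝔯 𝔢 𝔴 𝔈) x).HasRWExpH = HasRWExpHOfOps (ops312RY (𝔬12 x))) ∧
      (∀ x : MemberY θ.d₆ θ.ℓ₆ θ.hd' θ.hL' θ.b₀ θ.b₁ Mstar, ((opsYNuStOfRecordV4PE N θ Mstar 𝔯 𝔢 𝔴 𝔈) x).PosDefK = PosDefKOfOps (ops312RY (𝔬12 x))) := by
  subst h𝔈; exact ⟨fun _ => rfl, fun _ => rfl, fun _ => rfl, fun _ => rfl, fun _ => rfl, fun _ => rfl, fun _ => rfl⟩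

/-- ★★ the same seven pins at the PLAIN STAR instance of record `opsYStOfRecordV4PE` (site-(3.49) layer without the row-26 `ν`-read).
[cite: Balaban1985BackgroundPropagators, Thm 3.7 (3.90) p.409, Thm 3.9 (3.98)–(3.99) pp.412–413, Thm 3.10 (3.107)–(3.108) pp.415–416, Thm 3.11 p.416, Thm 3.12 p.423,
Thm 3.13 p.426, (3.35)–(3.36) p.396, bookkeeping] -/
theorem pinsSt_of_eq {𝔈 : ExpsY N θ Mstar}
    (h𝔈 : 𝔈 = expsYOfRecordV2 N θ Mstar 𝔯 𝔈₀ R₁ R₂ bI α' r39 B39 p q p3 q3 pM qM H 𝔬A rdA 𝔬12) :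
    (∀ x : MemberY θ.d₆ θ.ℓ₆ θ.hd' θ.hL' θ.b₀ θ.b₁ Mstar, rwKernelExpansionR R₁ R₂ ((opsYStOfRecordV4PE N θ Mstar 𝔯 𝔢 𝔴 𝔈) x).EK39 =
        EK39OfOpsBlkVia (oneCubeOps39YFR θ Mstar (lettersYOfRecordV4P N θ Mstar 𝔯) R₁ R₂ bI x) (oneCubeReading39 _) (θ.d₆ + 1)
          (2 * (1 * B39) * rowConst261 (geo9Y (d := θ.d₆) (ℓ := θ.ℓ₆) (hd := θ.hd') (hL := θ.hL') (b₀ := θ.b₀) (b₁ := θ.b₁) (Mstar := Mstar)) (α' * r39))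
          ((1 - α') * r39) (repSite39F x.toKIdx (bI x))) ∧
      (∀ x : MemberY θ.d₆ θ.ℓ₆ θ.hd' θ.hL' θ.b₀ θ.b₁ Mstar, ((opsYStOfRecordV4PE N θ Mstar 𝔯 𝔢 𝔴 𝔈) x).PosDef =
        PosDefOfOps (ops311Y x (lettersYOfRecordV4P N θ Mstar 𝔯 x) (proofLettersGA (lettersYOfRecordV4P N θ Mstar 𝔯 x)))) ∧
      (∀ x : MemberY θ.d₆ θ.ℓ₆ θ.hd' θ.hL' θ.b₀ θ.b₁ Mstar, rwExpansionR R₁ R₂ ((opsYStOfRecordV4PE N θ Mstar 𝔯 𝔢 𝔴 𝔈) x).E37 =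
        E37YPairMDir (bg := (bg9YR (Matrix (Fin N) (Fin N) ℂ) (specialUnitaryUnits (Fin N)) R₁ R₂)) (2 * (θ.d₆ + 1))
          (nbrCountY θ.d₆ θ.ℓ₆ θ.hd' θ.hL' θ.b₀ θ.b₁ 2) (Real.sqrt ((θ.d₆ + 1) * Fintype.card (TrIdx N))) ((θ.d₆ + 1 : ℕ) : ℝ) p q
          (⟨p3.N3, 2 * p3.B3, 0⟩ : PairPrims) (⟨q3.N3, 2 * q3.B3, 0⟩ : PairPrims) pM qM
          (opsWalkY x (trBasis N) (bg9YR (Matrix (Fin N) (Fin N) ℂ) (specialUnitaryUnits (Fin N)) R₁ R₂ x) (fun U => U) (parSymY x.toKIdx) (bI x))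
          (dirOpsWalkY x (trBasis N) (bg9YR (Matrix (Fin N) (Fin N) ℂ) (specialUnitaryUnits (Fin N)) R₁ R₂ x) (fun U => U) (parSymY x.toKIdx) (bI x))
          (dirLettersWalkY x (trBasis N) (bg9YR (Matrix (Fin N) (Fin N) ℂ) (specialUnitaryUnits (Fin N)) R₁ R₂ x) (fun U => U) (parSymY x.toKIdx) (bI x))
          (rdWalkY x (bg9YR (Matrix (Fin N) (Fin N) ℂ) (specialUnitaryUnits (Fin N)) R₁ R₂ x) (fun U => U) (parSymY x.toKIdx)) (H x)
          (kernelFamilyR R₁ R₂ ((opsYStOfRecordV4PE N θ Mstar 𝔯 𝔢 𝔴 𝔈) x).Gp)) ∧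
      (∀ x : MemberY θ.d₆ θ.ℓ₆ θ.hd' θ.hL' θ.b₀ θ.b₁ Mstar, rwExpansionR R₁ R₂ ((opsYStOfRecordV4PE N θ Mstar 𝔯 𝔢 𝔴 𝔈) x).E310 =
        E310YPairM (bg := (bg9YR (Matrix (Fin N) (Fin N) ℂ) (specialUnitaryUnits (Fin N)) R₁ R₂)) (2 * (θ.d₆ + 1))
          (nbrCountY θ.d₆ θ.ℓ₆ θ.hd' θ.hL' θ.b₀ θ.b₁ 2) (Real.sqrt ((θ.d₆ + 1) * Fintype.card (TrIdx N))) ((θ.d₆ + 1 : ℕ) : ℝ) p q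
          (⟨p3.N3, 2 * p3.B3, 0⟩ : PairPrims) (⟨q3.N3, 2 * q3.B3, 0⟩ : PairPrims) pM qM (𝔬A x) (rdA x) (H x)
          (kernelFamilyR R₁ R₂ ((opsYStOfRecordV4PE N θ Mstar 𝔯 𝔢 𝔴 𝔈) x).GA)) ∧
      (∀ x : MemberY θ.d₆ θ.ℓ₆ θ.hd' θ.hL' θ.b₀ θ.b₁ Mstar, ((opsYStOfRecordV4PE N θ Mstar 𝔯 𝔢 𝔴 𝔈) x).HasRWExp = HasRWExpOfOps (ops312RY (𝔬12 x))) ∧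
      (∀ x : MemberY θ.d₆ θ.ℓ₆ θ.hd' θ.hL' θ.b₀ θ.b₁ Mstar, ((opsYStOfRecordV4PE N θ Mstar 𝔯 𝔢 𝔴 𝔈) x).HasRWExpH = HasRWExpHOfOps (ops312RY (𝔬12 x))) ∧
      (∀ x : MemberY θ.d₆ θ.ℓ₆ θ.hd' θ.hL' θ.b₀ θ.b₁ Mstar, ((opsYStOfRecordV4PE N θ Mstar 𝔯 𝔢 𝔴 𝔈) x).PosDefK = PosDefKOfOps (ops312RY (𝔬12 x))) := by
  subst h𝔈; exact ⟨fun _ => rfl, fun _ => rfl, fun _ => rfl, fun _ => rfl, fun _ => rfl, fun _ => rfl, fun _ => rfl⟩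

variable {𝔢' : SectEY N θ Mstar}

/-- ★★ the same seven pins at the `ν`-read SOURCE instance of record `opsYNuOfRecordV4PE` (any source Sect.-E family `𝔢'`; the editions before the star
convention and the K1 closers read it). [cite: Balaban1985BackgroundPropagators, Thm 3.7 (3.90) p.409, Thm 3.9 (3.98)–(3.99) pp.412–413, Thm 3.10 (3.107)–(3.108) pp.415–416,
Thm 3.11 p.416, Thm 3.12 p.423, Thm 3.13 p.426, (3.35)–(3.36) p.396, bookkeeping] -/
theorem pinsNu_of_eq {𝔈 : ExpsY N θ Mstar}
    (h𝔈 : 𝔈 = expsYOfRecordV2 N θ Mstar 𝔯 𝔈₀ R₁ R₂ bI α' r39 B39 p q p3 q3 pM qM H 𝔬A rdA 𝔬12) :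
    (∀ x : MemberY θ.d₆ θ.ℓ₆ θ.hd' θ.hL' θ.b₀ θ.b₁ Mstar, rwKernelExpansionR R₁ R₂ ((opsYNuOfRecordV4PE N θ Mstar 𝔯 𝔢' 𝔴 𝔈) x).EK39 =
        EK39OfOpsBlkVia (oneCubeOps39YFR θ Mstar (lettersYOfRecordV4P N θ Mstar 𝔯) R₁ R₂ bI x) (oneCubeReading39 _) (θ.d₆ + 1)
          (2 * (1 * B39) * rowConst261 (geo9Y (d := θ.d₆) (ℓ := θ.ℓ₆) (hd := θ.hd') (hL := θ.hL') (b₀ := θ.b₀) (b₁ := θ.b₁) (Mstar := Mstar)) (α' * r39))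
          ((1 - α') * r39) (repSite39F x.toKIdx (bI x))) ∧
      (∀ x : MemberY θ.d₆ θ.ℓ₆ θ.hd' θ.hL' θ.b₀ θ.b₁ Mstar, ((opsYNuOfRecordV4PE N θ Mstar 𝔯 𝔢' 𝔴 𝔈) x).PosDef =
        PosDefOfOps (ops311Y x (lettersYOfRecordV4P N θ Mstar 𝔯 x) (proofLettersGA (lettersYOfRecordV4P N θ Mstar 𝔯 x)))) ∧
      (∀ x : MemberY θ.d₆ θ.ℓ₆ θ.hd' θ.hL' θ.b₀ θ.b₁ Mstar, rwExpansionR R₁ R₂ ((opsYNuOfRecordV4PE N θ Mstar 𝔯 𝔢' 𝔴 𝔈) x).E37 =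
        E37YPairMDir (bg := (bg9YR (Matrix (Fin N) (Fin N) ℂ) (specialUnitaryUnits (Fin N)) R₁ R₂)) (2 * (θ.d₆ + 1))
          (nbrCountY θ.d₆ θ.ℓ₆ θ.hd' θ.hL' θ.b₀ θ.b₁ 2) (Real.sqrt ((θ.d₆ + 1) * Fintype.card (TrIdx N))) ((θ.d₆ + 1 : ℕ) : ℝ) p q
          (⟨p3.N3, 2 * p3.B3, 0⟩ : PairPrims) (⟨q3.N3, 2 * q3.B3, 0⟩ : PairPrims) pM qM
          (opsWalkY x (trBasis N) (bg9YR (Matrix (Fin N) (Fin N) ℂ) (specialUnitaryUnits (Fin N)) R₁ R₂ x) (fun U => U) (parSymY x.toKIdx) (bI x))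
          (dirOpsWalkY x (trBasis N) (bg9YR (Matrix (Fin N) (Fin N) ℂ) (specialUnitaryUnits (Fin N)) R₁ R₂ x) (fun U => U) (parSymY x.toKIdx) (bI x))
          (dirLettersWalkY x (trBasis N) (bg9YR (Matrix (Fin N) (Fin N) ℂ) (specialUnitaryUnits (Fin N)) R₁ R₂ x) (fun U => U) (parSymY x.toKIdx) (bI x))
          (rdWalkY x (bg9YR (Matrix (Fin N) (Fin N) ℂ) (specialUnitaryUnits (Fin N)) R₁ R₂ x) (fun U => U) (parSymY x.toKIdx)) (H x)
          (kernelFamilyR R₁ R₂ ((opsYNuOfRecordV4PE N θ Mstar 𝔯 𝔢' 𝔴 𝔈) x).Gp)) ∧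
      (∀ x : MemberY θ.d₆ θ.ℓ₆ θ.hd' θ.hL' θ.b₀ θ.b₁ Mstar, rwExpansionR R₁ R₂ ((opsYNuOfRecordV4PE N θ Mstar 𝔯 𝔢' 𝔴 𝔈) x).E310 =
        E310YPairM (bg := (bg9YR (Matrix (Fin N) (Fin N) ℂ) (specialUnitaryUnits (Fin N)) R₁ R₂)) (2 * (θ.d₆ + 1))
          (nbrCountY θ.d₆ θ.ℓ₆ θ.hd' θ.hL' θ.b₀ θ.b₁ 2) (Real.sqrt ((θ.d₆ + 1) * Fintype.card (TrIdx N))) ((θ.d₆ + 1 : ℕ) : ℝ) p q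
          (⟨p3.N3, 2 * p3.B3, 0⟩ : PairPrims) (⟨q3.N3, 2 * q3.B3, 0⟩ : PairPrims) pM qM (𝔬A x) (rdA x) (H x)
          (kernelFamilyR R₁ R₂ ((opsYNuOfRecordV4PE N θ Mstar 𝔯 𝔢' 𝔴 𝔈) x).GA)) ∧
      (∀ x : MemberY θ.d₆ θ.ℓ₆ θ.hd' θ.hL' θ.b₀ θ.b₁ Mstar, ((opsYNuOfRecordV4PE N θ Mstar 𝔯 𝔢' 𝔴 𝔈) x).HasRWExp = HasRWExpOfOps (ops312RY (𝔬12 x))) ∧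
      (∀ x : MemberY θ.d₆ θ.ℓ₆ θ.hd' θ.hL' θ.b₀ θ.b₁ Mstar, ((opsYNuOfRecordV4PE N θ Mstar 𝔯 𝔢' 𝔴 𝔈) x).HasRWExpH = HasRWExpHOfOps (ops312RY (𝔬12 x))) ∧
      (∀ x : MemberY θ.d₆ θ.ℓ₆ θ.hd' θ.hL' θ.b₀ θ.b₁ Mstar, ((opsYNuOfRecordV4PE N θ Mstar 𝔯 𝔢' 𝔴 𝔈) x).PosDefK = PosDefKOfOps (ops312RY (𝔬12 x))) := by
  subst h𝔈; exact ⟨fun _ => rfl, fun _ => rfl, fun _ => rfl, fun _ => rfl, fun _ => rfl, fun _ => rfl, fun _ => rfl⟩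

/-- ★★ the same seven pins at the PLAIN SOURCE instance of record `opsYOfRecordV4PE` (def-Y's v6 ∕ v7 records are its instances).
[cite: Balaban1985BackgroundPropagators, Thm 3.7 (3.90) p.409, Thm 3.9 (3.98)–(3.99) pp.412–413, Thm 3.10 (3.107)–(3.108) pp.415–416, Thm 3.11 p.416, Thm 3.12 p.423,
Thm 3.13 p.426, (3.35)–(3.36) p.396, bookkeeping] -/
theorem pinsP_of_eq {𝔈 : ExpsY N θ Mstar}
    (h𝔈 : 𝔈 = expsYOfRecordV2 N θ Mstar 𝔯 𝔈₀ R₁ R₂ bI α' r39 B39 p q p3 q3 pM qM H 𝔬A rdA 𝔬12) :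
    (∀ x : MemberY θ.d₆ θ.ℓ₆ θ.hd' θ.hL' θ.b₀ θ.b₁ Mstar, rwKernelExpansionR R₁ R₂ ((opsYOfRecordV4PE N θ Mstar 𝔯 𝔢' 𝔴 𝔈) x).EK39 =
        EK39OfOpsBlkVia (oneCubeOps39YFR θ Mstar (lettersYOfRecordV4P N θ Mstar 𝔯) R₁ R₂ bI x) (oneCubeReading39 _) (θ.d₆ + 1)
          (2 * (1 * B39) * rowConst261 (geo9Y (d := θ.d₆) (ℓ := θ.ℓ₆) (hd := θ.hd') (hL := θ.hL') (b₀ := θ.b₀) (b₁ := θ.b₁) (Mstar := Mstar)) (α' * r39))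
          ((1 - α') * r39) (repSite39F x.toKIdx (bI x))) ∧
      (∀ x : MemberY θ.d₆ θ.ℓ₆ θ.hd' θ.hL' θ.b₀ θ.b₁ Mstar, ((opsYOfRecordV4PE N θ Mstar 𝔯 𝔢' 𝔴 𝔈) x).PosDef =
        PosDefOfOps (ops311Y x (lettersYOfRecordV4P N θ Mstar 𝔯 x) (proofLettersGA (lettersYOfRecordV4P N θ Mstar 𝔯 x)))) ∧
      (∀ x : MemberY θ.d₆ θ.ℓ₆ θ.hd' θ.hL' θ.b₀ θ.b₁ Mstar, rwExpansionR R₁ R₂ ((opsYOfRecordV4PE N θ Mstar 𝔯 𝔢' 𝔴 𝔈) x).E37 =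
        E37YPairMDir (bg := (bg9YR (Matrix (Fin N) (Fin N) ℂ) (specialUnitaryUnits (Fin N)) R₁ R₂)) (2 * (θ.d₆ + 1))
          (nbrCountY θ.d₆ θ.ℓ₆ θ.hd' θ.hL' θ.b₀ θ.b₁ 2) (Real.sqrt ((θ.d₆ + 1) * Fintype.card (TrIdx N))) ((θ.d₆ + 1 : ℕ) : ℝ) p q
          (⟨p3.N3, 2 * p3.B3, 0⟩ : PairPrims) (⟨q3.N3, 2 * q3.B3, 0⟩ : PairPrims) pM qM
          (opsWalkY x (trBasis N) (bg9YR (Matrix (Fin N) (Fin N) ℂ) (specialUnitaryUnits (Fin N)) R₁ R₂ x) (fun U => U) (parSymY x.toKIdx) (bI x))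
          (dirOpsWalkY x (trBasis N) (bg9YR (Matrix (Fin N) (Fin N) ℂ) (specialUnitaryUnits (Fin N)) R₁ R₂ x) (fun U => U) (parSymY x.toKIdx) (bI x))
          (dirLettersWalkY x (trBasis N) (bg9YR (Matrix (Fin N) (Fin N) ℂ) (specialUnitaryUnits (Fin N)) R₁ R₂ x) (fun U => U) (parSymY x.toKIdx) (bI x))
          (rdWalkY x (bg9YR (Matrix (Fin N) (Fin N) ℂ) (specialUnitaryUnits (Fin N)) R₁ R₂ x) (fun U => U) (parSymY x.toKIdx)) (H x)
          (kernelFamilyR R₁ R₂ ((opsYOfRecordV4PE N θ Mstar 𝔯 𝔢' 𝔴 𝔈) x).Gp)) ∧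
      (∀ x : MemberY θ.d₆ θ.ℓ₆ θ.hd' θ.hL' θ.b₀ θ.b₁ Mstar, rwExpansionR R₁ R₂ ((opsYOfRecordV4PE N θ Mstar 𝔯 𝔢' 𝔴 𝔈) x).E310 =
        E310YPairM (bg := (bg9YR (Matrix (Fin N) (Fin N) ℂ) (specialUnitaryUnits (Fin N)) R₁ R₂)) (2 * (θ.d₆ + 1))
          (nbrCountY θ.d₆ θ.ℓ₆ θ.hd' θ.hL' θ.b₀ θ.b₁ 2) (Real.sqrt ((θ.d₆ + 1) * Fintype.card (TrIdx N))) ((θ.d₆ + 1 : ℕ) : ℝ) p q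
          (⟨p3.N3, 2 * p3.B3, 0⟩ : PairPrims) (⟨q3.N3, 2 * q3.B3, 0⟩ : PairPrims) pM qM (𝔬A x) (rdA x) (H x)
          (kernelFamilyR R₁ R₂ ((opsYOfRecordV4PE N θ Mstar 𝔯 𝔢' 𝔴 𝔈) x).GA)) ∧
      (∀ x : MemberY θ.d₆ θ.ℓ₆ θ.hd' θ.hL' θ.b₀ θ.b₁ Mstar, ((opsYOfRecordV4PE N θ Mstar 𝔯 𝔢' 𝔴 𝔈) x).HasRWExp = HasRWExpOfOps (ops312RY (𝔬12 x))) ∧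
      (∀ x : MemberY θ.d₆ θ.ℓ₆ θ.hd' θ.hL' θ.b₀ θ.b₁ Mstar, ((opsYOfRecordV4PE N θ Mstar 𝔯 𝔢' 𝔴 𝔈) x).HasRWExpH = HasRWExpHOfOps (ops312RY (𝔬12 x))) ∧
      (∀ x : MemberY θ.d₆ θ.ℓ₆ θ.hd' θ.hL' θ.b₀ θ.b₁ Mstar, ((opsYOfRecordV4PE N θ Mstar 𝔯 𝔢' 𝔴 𝔈) x).PosDefK = PosDefKOfOps (ops312RY (𝔬12 x))) := by
  subst h𝔈; exact ⟨fun _ => rfl, fun _ => rfl, fun _ => rfl, fun _ => rfl, fun _ => rfl, fun _ => rfl, fun _ => rfl⟩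

end Faces

end Literature.MathematicalPhysics.QuantumFieldTheory.Balaban1983to89.Node00.OpsYExpsOfRecordV2

end
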